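import Summits.QuantumFields.YangMills.Theorems.IsotropyFromPowerCountingTemperedCurvatureMomentsOfBddRenormalisation

/-!
# Tied families along bounded-renormalisation schemes are of order zero: `|𝔖ₙ(f₁ ⊗ ⋯ ⊗ fₙ)| ≤ Cⁿ ∏ᵢ ‖fᵢ‖_{L¹}`

Support file for the item `IsotropyFromPowerCounting.TemperedCurvatureMoments` (T, stmt-QuantumFields-17721), sequel of
`IsotropyFromPowerCountingTemperedCurvatureMomentsOfBddRenormalisation.lean` (lead c5 of crux stmt-14999, line `Sketch`).

There the true renormalised Wilson densities `D_k = c_kⁿ W_k` of a scheme with bounded multiplicative renormalisation of the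
curvature species (`|c_k| ≤ B`) were shown to be bounded, `|D_k(x)| ≤ (2BM + K)ⁿ` for `k ≥ k₁`, at ALL multi-sites.  Since
the lattice `n`-point function is the Riemann sum `(a_k⁴)ⁿ Σₓ ∏ᵢ fᵢ(a_k xᵢ) D_k(x)`, it is bounded by
`(2BM+K)ⁿ ∏ᵢ (a_k⁴ Σ_y |fᵢ(a_k y)|)`, and the Riemann sums of `|fᵢ|` converge to `‖fᵢ‖_{L¹}`
(`tendsto_riemannSum_box_abs`, dominated convergence with the toolkit's integrable majorant).  Passing to the limit through
the tie:

* `norm_schwinger_le_of_bddRenormalisation` — for every family `S₁` tied to `(r, sch)` with `sup_k |c_k| < ∞` there is `C ≥ 0`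
  with `‖S₁ n F‖ ≤ Cⁿ ∏ᵢ ∫ |fᵢ|` for every `n ≥ 1` and every off-diagonal real tensor `F = ⊗ᵢ fᵢ`.

So the degenerate (bounded-renormalisation) sector of `W1` consists of families whose restrictions to off-diagonal real tensors
are multilinear functionals bounded in `L¹ × ⋯ × L¹` with geometric constants (order-zero, `L^∞`-density families): every
singular or junk-like behaviour, and the whole content of the cruxes fed by T, sits in the regime `sup_k |c_k| = ∞`.

References: Glimm–Jaffe 1987 §6.1; Osterwalder–Schrader 1973 §2; Jaffe–Witten 2000 §6.
-/

noncomputable section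

open scoped SchwartzMap BigOperators
open MeasureTheory Filter Topology
open Literature.MathematicalPhysics.QuantumFieldTheory Literature.MathematicalPhysics.QuantumLattice
open Literature.MathematicalPhysics.AQFT
open Literature.Probability.LatticeModels (box Site)
open Summit.QuantumFields.YangMills.Theorems.OSLegsFromFemtoAndGap (torusMoment)
open Summit.QuantumFields.YangMills.Theorems.NPointIsotropy.ComplexRotationBandlimit
  (integral_step step_apply norm_step_le integrable_majorant integrable_step tendsto_smul_floor eventually_floor_mem_box)
open Summit.QuantumFields.YangMills.Theorems.CurvatureBoostCovariance.Negative (Tie)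
open Summit.QuantumFields.YangMills.Theorems.NPointIsotropy.Negative (E4)

namespace Summit.QuantumFields.YangMills.Theorems.SoftKernelBoostCovariance.Sketch

/-! ## Riemann sums of `|g|` for a Schwartz function `g` -/

/-- **Riemann sums of `|g|` over the exploding fine boxes converge to `∫ |g|`** (`g` Schwartz on `ℝ⁴`; spacings `a_k > 0`,
`a_k → 0`, half-sides `L_k` with `a_k L_k → ∞`).  Same dominated-convergence argument as the toolkit's
`tendsto_riemannSum_box`, run for the continuous integrand `|g|` with the Schwartz majorant of `g`. -/
theorem tendsto_riemannSum_box_abs (g : 𝓢(E4, ℝ)) (a : ℕ → ℝ) (L : ℕ → ℕ)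
    (ha : ∀ k, 0 < a k) (ha0 : Tendsto a atTop (𝓝 0))
    (haL : Tendsto (fun k => a k * L k) atTop atTop) :
    Tendsto (fun k => a k ^ 4 * ∑ y ∈ box 4 (L k), |g (a k • siteToE y)|) atTop (𝓝 (∫ x, |g x|)) := by
  obtain ⟨M, hM⟩ : ∃ M : ℝ, ∀ z : E4, (1 + ‖z‖) ^ (4 + 1) * ‖|g z|‖ ≤ M := by
    refine ⟨2 ^ (4 + 1) * (Finset.Iic (4 + 1, 0)).sup (fun m => SchwartzMap.seminorm ℝ m.1 m.2) g,
      fun z => ?_⟩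
    have h := SchwartzMap.one_add_le_sup_seminorm_apply (𝕜 := ℝ) (m := (4 + 1, 0)) (k := 4 + 1)
      (n := 0) le_rfl le_rfl g z
    rw [norm_iteratedFDeriv_zero] at h
    simpa [Real.norm_eq_abs] using h
  have hfun : (fun k => a k ^ 4 * ∑ y ∈ box 4 (L k), |g (a k • siteToE y)|) = fun k =>
      ∫ x : E4, ∑ y ∈ box 4 (L k), {z : E4 |
        ∀ i, z i ∈ Set.Ico (a k * (y i : ℝ)) (a k * (y i : ℝ) + a k)}.indicator
          (fun _ => |g (a k • siteToE y)|) x :=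
    funext fun k => (integral_step (fun z => |g z|) (ha k).le (L k)).symm
  rw [hfun]
  refine tendsto_integral_filter_of_dominated_convergence
    (fun x => M * ((4 : ℝ) + 1) ^ (4 + 1) * ((1 + ‖x‖) ^ (4 + 1))⁻¹) ?_ ?_ ?_ ?_
  · exact Eventually.of_forall fun k => (integrable_step (fun z => |g z|) (ha k).le (L k)).aestronglyMeasurable
  · filter_upwards [ha0.eventually (eventually_le_nhds zero_lt_one)] with k hk
    refine ae_of_all _ fun x => ?_
    rw [step_apply (fun z => |g z|) (ha k)]
    exact_mod_cast norm_step_le (d := 4) hM (ha k) hk (L k) x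
  · exact_mod_cast integrable_majorant (d := 4) M
  · refine ae_of_all _ fun x => ?_
    have hc : Continuous fun z : E4 => |g z| := continuous_abs.comp g.continuous
    have h1 : Tendsto (fun k => |g (a k • siteToE (fun i => ⌊x i / a k⌋))|) atTop (𝓝 (|g x|)) :=
      (hc.tendsto x).comp (tendsto_smul_floor ha ha0 x)
    refine h1.congr' ?_
    filter_upwards [eventually_floor_mem_box ha haL x] with k hk
    rw [step_apply (fun z => |g z|) (ha k), if_pos hk]

/-! ## The order-zero bound -/

variable {G : Type} [Group G] [TopologicalSpace G] [IsTopologicalGroup G] [CompactSpace G]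
  [MeasurableSpace G] [BorelSpace G]

omit [TopologicalSpace G] [IsTopologicalGroup G] [CompactSpace G] [BorelSpace G] in
/-- **Lattice side**: with `|D_k| ≤ Aⁿ` at all multi-sites, the Riemann sum of T is bounded by
`Aⁿ ∏ᵢ (a_k⁴ Σ_y |fᵢ(a_k y)|)`. -/
theorem abs_riemannSum_le_prod (sch : SpeciesScheme (YMSpecies G)) (k n : ℕ) (f : Fin n → 𝓢(E4, ℝ))
    (D : (Fin n → Site 4) → ℝ) {A : ℝ}
    (hD : ∀ x : Fin n → Site 4, |D x| ≤ A ^ n) :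
    |(sch.a k ^ 4) ^ n * ∑ x ∈ Fintype.piFinset (fun _ : Fin n => box 4 (sch.L k)),
        (∏ i, f i (sch.a k • siteToE (x i))) * D x| ≤
      A ^ n * ∏ i, (sch.a k ^ 4 * ∑ y ∈ box 4 (sch.L k), |f i (sch.a k • siteToE y)|) := by
  have ha4 : 0 ≤ sch.a k ^ 4 := pow_nonneg (sch.a_pos k).le 4
  calc |(sch.a k ^ 4) ^ n * ∑ x ∈ Fintype.piFinset (fun _ : Fin n => box 4 (sch.L k)),
          (∏ i, f i (sch.a k • siteToE (x i))) * D x|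
      ≤ (sch.a k ^ 4) ^ n * ∑ x ∈ Fintype.piFinset (fun _ : Fin n => box 4 (sch.L k)),
          (∏ i, |f i (sch.a k • siteToE (x i))|) * A ^ n := by
        rw [abs_mul, abs_of_nonneg (pow_nonneg ha4 n)]
        refine mul_le_mul_of_nonneg_left ((Finset.abs_sum_le_sum_abs _ _).trans
          (Finset.sum_le_sum fun x _ => ?_)) (pow_nonneg ha4 n)
        rw [abs_mul, Finset.abs_prod]
        exact mul_le_mul_of_nonneg_left (hD x) (Finset.prod_nonneg fun i _ => abs_nonneg _)
    _ = A ^ n * ((sch.a k ^ 4) ^ n * ∑ x ∈ Fintype.piFinset (fun _ : Fin n => box 4 (sch.L k)),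
          ∏ i, |f i (sch.a k • siteToE (x i))|) := by
        rw [← Finset.sum_mul]; ring
    _ = A ^ n * ∏ i, (sch.a k ^ 4 * ∑ y ∈ box 4 (sch.L k), |f i (sch.a k • siteToE y)|) := by
        congr 1
        rw [Finset.prod_mul_distrib, Finset.prod_const, Finset.card_univ, Fintype.card_fin,
          Finset.prod_univ_sum]

/-- **TIED FAMILIES ALONG BOUNDED-RENORMALISATION SCHEMES ARE OF ORDER ZERO.**  If `S₁` is tied to `(r, sch)` (first clause
of `W1`) and the multiplicative renormalisation of the curvature species is bounded, `|c_k| ≤ B`, then there is `C ≥ 0` such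
that for every degree `n ≥ 1`, all real test functions `f₁, …, fₙ` and every off-diagonal tensor witness `F = ⊗ᵢ fᵢ`:
`‖S₁ n F‖ ≤ Cⁿ ∏ᵢ ∫ |fᵢ|`.  (`C = 2BM + K`: `M` a bound of the Wilson action density, `K` a bound of the renormalised mean
`κ_k = c_k(⟨F⟩_k − m_k)`, bounded by the degree-one tie.) -/
theorem norm_schwinger_le_of_bddRenormalisation (r : LatticeRep G) (sch : SpeciesScheme (YMSpecies G))
    (S₁ : SchwingerFamily E4) (htie : Tie r sch S₁) (hB : ∃ B : ℝ, ∀ k : ℕ, |sch.c r.curvature k| ≤ B) :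
    ∃ C : ℝ, 0 ≤ C ∧ ∀ n : ℕ, n ≠ 0 → ∀ (f : Fin n → 𝓢(E4, ℝ)) (F : 𝓢((Fin n → E4), ℂ)),
      IsTensorOf F (fun i => ofRealTest (f i)) → IsOffDiagonal F →
        ‖S₁ n F‖ ≤ C ^ n * ∏ i, ∫ x, |f i x| := by
  obtain ⟨B, hB⟩ := hB
  obtain ⟨M, hM⟩ := r.curvature.bounded
  obtain ⟨K, hK⟩ := eventually_abs_renormalisedMean_le r sch S₁ htie
  obtain ⟨k₁, hk₁⟩ := eventually_atTop.1 hK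
  have hM0 : 0 ≤ M := (abs_nonneg _).trans (hM fun _ => 1)
  have hB0 : 0 ≤ B := (abs_nonneg _).trans (hB 0)
  have hK0 : 0 ≤ K := (abs_nonneg _).trans (hk₁ k₁ le_rfl)
  refine ⟨2 * B * M + K, by positivity, fun n hn f F hF hF' => ?_⟩
  set A := 2 * B * M + K with hAdef
  -- the lattice `n`-point functions and their bound
  set Lk : ℕ → ℂ := fun k => ((latticeSchwinger r.ρ sch (fun s => s.F) k n (fun _ => r.curvature) f : ℝ) : ℂ)
  set bk : ℕ → ℝ := fun k => A ^ n * ∏ i, (sch.a k ^ 4 * ∑ y ∈ box 4 (sch.L k), |f i (sch.a k • siteToE y)|)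
  have hconv : Tendsto Lk atTop (𝓝 (S₁ n F)) := htie n hn f F hF hF'
  have hbconv : Tendsto bk atTop (𝓝 (A ^ n * ∏ i, ∫ x, |f i x|)) :=
    (tendsto_finsetProd _ fun i _ =>
      tendsto_riemannSum_box_abs (f i) sch.a sch.L sch.a_pos sch.tendsto_a sch.tendsto_L).const_mul _
  have hle : ∀ᶠ k in atTop, ‖Lk k‖ ≤ bk k := by
    refine eventually_atTop.2 ⟨k₁, fun k hk => ?_⟩
    have hD : ∀ x : Fin n → Site 4,
        |(sch.c r.curvature k) ^ n *
          torusMoment r.ρ (sch.β k) (sch.L k) r.curvature.F (sch.m r.curvature k) x| ≤ A ^ n :=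
      fun x => abs_trueDensity_le r sch hM k (hB k) (hk₁ k hk) x
    have hid := riemannSum_trueDensity_eq_latticeSchwinger r sch k n f F hF
    simp only [Lk]
    rw [← hid, Complex.norm_real, Real.norm_eq_abs]
    exact abs_riemannSum_le_prod sch k n f _ hD
  exact le_of_tendsto_of_tendsto hconv.norm hbconv hle

end Summit.QuantumFields.YangMills.Theorems.SoftKernelBoostCovariance.Sketch

end

noncomputable section

open scoped SchwartzMap BigOperators
open MeasureTheory Filter Topology
open Literature.MathematicalPhysics.QuantumFieldTheory Literature.MathematicalPhysics.QuantumLattice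
open Literature.MathematicalPhysics.AQFT
open Literature.Probability.LatticeModels (box Site)
open Summit.QuantumFields.YangMills.Theorems.OSLegsFromFemtoAndGap (torusMoment)
open Summit.QuantumFields.YangMills.Theorems.NPointIsotropy.Negative (E4)

namespace Summit.QuantumFields.YangMills.Theorems.SoftKernelBoostCovariance.Sketch

variable {G : Type} [Group G] [TopologicalSpace G] [IsTopologicalGroup G] [CompactSpace G]
  [MeasurableSpace G] [BorelSpace G]

/-! ## Appendix (lead c5, same seat): degree one of T holds along EVERY tied scheme

No hypothesis on the renormalisation: the degree-one true density is the renormalised mean `κ_k = c_k(⟨F⟩_k − m_k)`,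
a constant in the site, which the degree-one tie keeps bounded (`eventually_abs_renormalisedMean_le`); its Riemann sums are
the lattice one-point functions.  So the `n = 1` layer of the item `TemperedCurvatureMoments` is settled for all schemes;
with the kernel triple of the crux (`CurvatureKernelBound`) the `n = 2` layer is the kernel itself (`D_k(x) = K(a_k(x₀ − x₁))`,
tempered by `|K| ≤ C(1 + ‖·‖^{η−10})`, Riemann sums by `tendsto_riemannSum_piBox` and the flat decay of `⁰𝒮` tensors) — the
genuine Yang–Mills content of T is `n ≥ 3` at `sup_k |c_k| = ∞`. -/

namespace DegreeOne

open Summit.QuantumFields.YangMills.Theorems.OSLegsFromFemtoAndGap (integrable_dens_lift torusE_dens_eq_wilsonTorusMean)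
open Summit.QuantumFields.YangMills.Cruxes.OSLegsFromFemtoAndGap.DlrCollarTransfer (torusE dens)
open Summit.QuantumFields.YangMills.Theorems.CurvatureBoostCovariance.Negative (W1 EightFrameRP PlanarCone)

/-- **The degree-one true density is the renormalised mean**: `c_k · W_k(x) = c_k (⟨F⟩_k − m_k)` for every
`x : Fin 1 → Site 4` (translation invariance of Wilson's torus measure). -/
theorem trueDensity_one_eq (r : LatticeRep G) (sch : SpeciesScheme (YMSpecies G)) (k : ℕ) (x : Fin 1 → Site 4) :
    (sch.c r.curvature k) ^ 1 * torusMoment r.ρ (sch.β k) (sch.L k) r.curvature.F (sch.m r.curvature k) x =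
      sch.c r.curvature k *
        (wilsonTorusMean r.ρ (sch.β k) (sch.L k) r.curvature.F - sch.m r.curvature k) := by
  set β := sch.β k
  set L := sch.L k
  set m := sch.m r.curvature k
  haveI := isProbabilityMeasure_wilsonMeasure (d := 4) (L := 2 * L + 1) r.ρ r.continuous β
  have hiD : Integrable (fun U : GaugeConfig 4 (2 * L + 1) G =>
      r.curvature.F (configShift (-(x 0)) (torusLift (2 * L + 1) U)))
      (wilsonMeasure (d := 4) (L := 2 * L + 1) r.ρ β) := integrable_dens_lift r β L (x 0)
  have hmean : (∫ U : GaugeConfig 4 (2 * L + 1) G,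
      (r.curvature.F (configShift (-(x 0)) (torusLift (2 * L + 1) U)) - m)
        ∂(wilsonMeasure (d := 4) (L := 2 * L + 1) r.ρ β)) =
      wilsonTorusMean r.ρ β L r.curvature.F - m := by
    rw [integral_sub hiD (integrable_const _), integral_const]
    have h := torusE_dens_eq_wilsonTorusMean (G := G) r β L (x 0)
    simp only [torusE, dens] at h
    simp [h]
  rw [pow_one]
  congr 1
  unfold torusMoment
  simp only [Fin.prod_univ_one]
  exact hmean

/-- **DEGREE ONE OF `TemperedCurvatureMoments` ALONG EVERY TIED SCHEME.**  For every compact simple `G`, `r`, `sch`, `S₁`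
with `W1 r sch S₁` (only the tie is used; the eight frames and the cone are idle): the degree-one conclusion of T holds with
the true density `D_k = c_k W_k = κ_k` (bounded by `K` for `k ≥ k₁`, so `C = K + 1`, `N = 0`). -/
theorem temperedCurvatureMoments_one :
    ∀ (G : Type) [Group G] [TopologicalSpace G] [IsTopologicalGroup G] [CompactSpace G]
      [MeasurableSpace G] [BorelSpace G], IsCompactSimpleLieGroup G →
      ∀ (r : LatticeRep G) (sch : SpeciesScheme (YMSpecies G)) (S₁ : SchwingerFamily E4),
        W1 r sch S₁ → EightFrameRP S₁ → PlanarCone S₁ →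
        ∃ (D : ℕ → (Fin 1 → Site 4) → ℝ) (C : ℝ) (N k₀ : ℕ), 0 < C ∧
          (∀ k : ℕ, k₀ ≤ k → ∀ x : Fin 1 → Site 4, (∀ i, x i ∈ box 4 (sch.L k)) → Function.Injective x →
            |D k x| ≤ C * (1 + ‖fun i => sch.a k • siteToE (x i)‖) ^ N *
              (1 + ∑ i, ∑ j ∈ Finset.univ.erase i,
                ‖sch.a k • siteToE (x i) - sch.a k • siteToE (x j)‖⁻¹) ^ N) ∧
          ∀ (f : Fin 1 → SchwartzMap E4 ℝ) (F : SchwartzMap (Fin 1 → E4) ℂ),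
            IsTensorOf F (fun i => ofRealTest (f i)) → IsOffDiagonal F →
            Filter.Tendsto (fun k => (((sch.a k ^ 4) ^ 1 *
              ∑ x ∈ Fintype.piFinset (fun _ : Fin 1 => box 4 (sch.L k)),
                (∏ i, f i (sch.a k • siteToE (x i))) * D k x : ℝ) : ℂ)) Filter.atTop (nhds (S₁ 1 F)) := by
  intro G _ _ _ _ _ _ _ r sch S₁ hW _ _
  obtain ⟨K, hK⟩ := eventually_abs_renormalisedMean_le r sch S₁ hW.1
  obtain ⟨k₁, hk₁⟩ := eventually_atTop.1 hK
  have hK0 : 0 ≤ K := (abs_nonneg _).trans (hk₁ k₁ le_rfl)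
  refine temperedCurvatureMoments_of_trueDensity_tempered r sch S₁ hW.1 one_pos
    ⟨K + 1, 0, k₁, by positivity, fun k hk x _ _ => ?_⟩
  rw [trueDensity_one_eq, pow_zero, pow_zero, mul_one, mul_one]
  exact (hk₁ k hk).trans (le_add_of_nonneg_right zero_le_one)

end DegreeOne

end Summit.QuantumFields.YangMills.Theorems.SoftKernelBoostCovariance.Sketch

end
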